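import Summits.CriticalPhenomena.PercolationContinuityZ3.Theorems.Transplant.SkelExcess
import Summits.CriticalPhenomena.PercolationContinuityZ3.Theorems.Transplant.SkelTubeLevels
import Summits.CriticalPhenomena.PercolationContinuityZ3.Theorems.Transplant.KNLevelsEntrance
import Summits.CriticalPhenomena.PercolationContinuityZ3.Theorems.Transplant.BoxProdZ2SeedGeom
import Literature.Probability.Percolation.KozmaNitzanHittable
import HarnessLib

/-!
# The EXCESS DISCHARGE over the window graph of a planar skeleton (generic re-typing of `BoxProdZ2ConcExcess`, `HOME/SHEAR-SCOPE.md`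
# §3.5 / §3.9 Layer 4, file L4.7): `P_W(⋃_{t ∈ Rim} {root ↔ t}) ≤ η` for the rim part of an enlarged target, from (i) the entrance
# reduction `KNLevels.real_biUnion_openConn_le_linkIn` (every positive-weight entrance into the habitat `D` is deep: graph distance
# `≤ R₀'` from the centre), (ii) the excess event `Skel.excess` (the rim lies beyond depth `R − L'`), (iii) the subbox transfer
# `real_excess_eq` (window graph `Skel.winGraph` ↦ `G`, p1-g7's `real_eq_of_determinedBy_window`), (iv) p3-g4's excess radius
# `Skel.exists_excess_radius` — here also made UNIFORM IN THE CENTRE (`exists_excess_radius_uniform`, via the degree bound (μ):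
# `|B_G(c, ρ)| ≤ (Δ+1)^ρ` for every `c`), which the wired-source form at a contact's centre consumes

builds on p205010 (kernel theorem, internal audit signed; external expert review pending) — nothing in this file uses p205010.
Lane `prim-bschramm`, typed by the `prim-hp-8` lineage (gen 22) on the general-node order of battle (lead 2026-08-20T17:48:43Z /
18:17:50Z); helper file (`--supports stmt-CriticalPhenomena-4575 --as helper`).  NEW FILE over `SkelExcess` (p3-g4) and `SkelTubeLevels` (p1-g7).
No frames appear: the product's `excess_le_of_frame … (Iso.refl) v` (planar translation of the footprint) is replaced by the footprint-free
planar-DIAMETER hypothesis of `Skel.exists_excess_radius`, and the frame `γ c ∈ V₀` of the wired-source form by centre-uniformity.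

* `real_excess_eq` — `P_{Wt}(excess w₀ R D A) = P_q(excess w₀ R D A)` for a subbox `Wt` of `winGraph G w₁ Rπ` on `D ⊆ B_G(w₁, Rπ)`;
* **`real_rim_le_excess`** — `P_{Wt}(⋃_{t ∈ Rim} root ↔ t) ≤ P_q(excess w₀ (R − L') D {v ∈ D | v ∈ B_G(w₀, R₀')})` for a weighting vanishing
  off `G.edgeSet` that is a subbox of a window graph on `D`, `root ∉ D`, `Rim ⊆ D` beyond depth `R − L'`, positive-weight entrances at depth `≤ R₀'`;
* **`real_rim_le_of_radius`** — hence `≤ η` once `R − L' ≥ R₁`, with `hR₁` in the shape of `Skel.exists_excess_radius` (habitat inside a ball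
  about `w₀`, planar diameter `≤ m`);
* **`exists_excess_radius_uniform`** — ONE radius for ALL centres: `∃ R₁, ∀ c, ∀ R ≥ R₁, ∀ Rw D A, … ⇒ P_q(excess c R D A) ≤ η`;
* §2 **`real_rim_le_of_wired_source`** — the rim excess of a chain from a WIRED source set `S` under the law cut to its world `Qt` (the inner
  elongated routes about a contact's centre `c`), consuming the centre-uniform radius.
[cite: KozmaNitzan2024, §4 Lemma 12 (p. 24: the faces on the boundary of the slab), Lemma 11 (p. 22)] [cite: MartineauSevero2019, Cor. 2.2]
-/

noncomputable section

open MeasureTheory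

namespace Summit.CriticalPhenomena.PercolationContinuityZ3.Theorems

namespace Transplant

namespace Skel

open Literature.Probability.Percolation Literature.Probability.LatticeModels SimpleGraph KNLevels
open Literature.Probability.Percolation.GM
open Literature.Barriers.CriticalPhenomena (graphBall graphBall_finite mem_graphBall_self graphBall_mono)
open KozmaNitzan (wireSet_mono)
open BoxProdZ2 (ballFin mem_ballFin card_ballFin_le)

open scoped Classical

variable {V : Type}

section Free

variable (G : SimpleGraph V) [G.LocallyFinite]

/-! ## §1 The rim excess of a subbox weighting of a window graph -/

/-- **The excess probability under a subbox weighting of a window graph** equals the `P_q` one on `G` (the event is determined by the pairs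
inside `D ⊆ B_G(w₁, R_π)`). [folklore] -/
theorem real_excess_eq [Countable V] {w₁ : V} {Rπ : ℕ} {Wt : Sym2 V → unitInterval} {q : unitInterval} {D : Finset V}
    (hWD : IsSubbox (winGraph G w₁ Rπ) Wt q D) (hDπ : ∀ v ∈ D, v ∈ graphBall G w₁ Rπ) (w₀ : V) (R : ℕ) (A : Finset V) :
    (prodBernoulli Wt).real (excess G w₀ R D A) = (bondPercolation G q).real (excess G w₀ R D A) := by
  rw [hWD.real_eq_bondPercolation (determinedBy_excess G w₀ R D A) (measurableSet_excess G w₀ R D A)]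
  exact real_eq_of_determinedBy_window q
    ((determinedBy_excess G w₀ R D A).mono (wireSet_mono fun v hv => hDπ v (Finset.mem_coe.1 hv))) (measurableSet_excess G w₀ R D A)

/-- **Rim excess ≤ excess probability.**  For a weighting `Wt` vanishing off the edges of `G` that is a subbox of the window graph
`winGraph G w₁ R_π` on `D ⊆ B_G(w₁, R_π)`, a source `root ∉ D`, a rim `Rim ⊆ D` beyond depth `R − L'` from `w₀`, and entrances of positive
weight landing at depth `≤ R₀'`: `P_{Wt}(⋃_{t ∈ Rim} root ↔ t) ≤ P_q(excess w₀ (R − L') D {v ∈ D | v ∈ B_G(w₀, R₀')})`.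
[cite: KozmaNitzan2024, §4 Lemma 12 (p. 24)] -/
theorem real_rim_le_excess [Countable V] {w₁ : V} {Rπ : ℕ} {Wt : Sym2 V → unitInterval} {q : unitInterval} {D : Finset V}
    (hWD : IsSubbox (winGraph G w₁ Rπ) Wt q D) (hDπ : ∀ v ∈ D, v ∈ graphBall G w₁ Rπ) (hWG : ∀ e, e ∉ G.edgeSet → Wt e = 0)
    {root : V} (hroot : root ∉ D) {w₀ : V} {R L' R₀' : ℕ} {Rim : Finset V} (hRimD : Rim ⊆ D)
    (hRimfar : ∀ t ∈ Rim, t ∉ graphBall G w₀ (R - L'))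
    (hA : ∀ a b, a ∉ D → b ∈ D → G.Adj a b → Wt s(a, b) ≠ 0 → b ∈ graphBall G w₀ R₀') :
    (prodBernoulli Wt).real (⋃ t ∈ Rim, openConn root t) ≤
      (bondPercolation G q).real (excess G w₀ (R - L') D (D.filter fun v => v ∈ graphBall G w₀ R₀')) := by
  set A := D.filter fun v => v ∈ graphBall G w₀ R₀' with hAdef
  -- entrances
  have h1 := real_biUnion_openConn_le_linkIn (G := G) hWG hRimD hroot (A := A)
    (fun a b ha hb hab hw => Finset.mem_filter.2 ⟨hb, hA a b ha hb hab hw⟩)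
  -- the rim lies in the far set
  have h2 : linkIn (↑D : Set V) A Rim ⊆ excess G w₀ (R - L') D A := by
    rw [excess]
    exact linkIn_mono le_rfl le_rfl fun t ht => Finset.mem_filter.2 ⟨hRimD ht, hRimfar t ht⟩
  calc (prodBernoulli Wt).real (⋃ t ∈ Rim, openConn root t)
      ≤ (prodBernoulli Wt).real (linkIn (↑D : Set V) A Rim) := h1
    _ ≤ (prodBernoulli Wt).real (excess G w₀ (R - L') D A) := measureReal_mono h2 (measure_ne_top _ _)
    _ = (bondPercolation G q).real (excess G w₀ (R - L') D A) := real_excess_eq G hWD hDπ w₀ (R - L') A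

end Free

/-! ## §2 The excess radius, uniform in the centre; the two discharges -/

variable {G : SimpleGraph V} [G.LocallyFinite] (Φ : PlanarSkeletonConc G)

/-- **Rim excess ≤ η** from an excess radius at the running parameter: with `hR₁` the conclusion of `Skel.exists_excess_radius Φ hC w₀ R₀' m η`
(at `q`), `R₁ ≤ R − L'`, the habitat inside `B_G(w₀, R_w)` and of planar diameter `≤ m`.
[cite: KozmaNitzan2024, §4 Lemma 12 (p. 24)] [cite: MartineauSevero2019, Cor. 2.2] -/
theorem real_rim_le_of_radius [Countable V] {w₁ : V} {Rπ : ℕ} {Wt : Sym2 V → unitInterval} {q : unitInterval} {D : Finset V}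
    (hWD : IsSubbox (winGraph G w₁ Rπ) Wt q D) (hDπ : ∀ v ∈ D, v ∈ graphBall G w₁ Rπ) (hWG : ∀ e, e ∉ G.edgeSet → Wt e = 0)
    {root : V} (hroot : root ∉ D) {w₀ : V} {R L' R₀' : ℕ} {Rim : Finset V} (hRimD : Rim ⊆ D)
    (hRimfar : ∀ t ∈ Rim, t ∉ graphBall G w₀ (R - L'))
    (hA : ∀ a b, a ∉ D → b ∈ D → G.Adj a b → Wt s(a, b) ≠ 0 → b ∈ graphBall G w₀ R₀')
    {m : ℕ} {η : ℝ} {R₁ : ℕ}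
    (hR₁ : ∀ R', R₁ ≤ R' → ∀ (Rw : ℕ) (D' A' : Finset V), (∀ d ∈ D', d ∈ graphBall G w₀ Rw) →
      (∀ d ∈ D', ∀ d' ∈ D', Φ.φ d - Φ.φ d' ∈ box 2 m) → A' ⊆ D' → (∀ a ∈ A', a ∈ graphBall G w₀ R₀') →
        (bondPercolation G q).real (excess G w₀ R' D' A') ≤ η)
    (hR : R₁ ≤ R - L') {Rw : ℕ} (hDw : ∀ d ∈ D, d ∈ graphBall G w₀ Rw) (hDm : ∀ d ∈ D, ∀ d' ∈ D, Φ.φ d - Φ.φ d' ∈ box 2 m) :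
    (prodBernoulli Wt).real (⋃ t ∈ Rim, openConn root t) ≤ η := by
  refine (real_rim_le_excess G hWD hDπ hWG hroot hRimD hRimfar hA).trans ?_
  exact hR₁ _ hR Rw D _ hDw hDm (Finset.filter_subset _ _) fun a ha => (Finset.mem_filter.1 ha).2

/-- **One excess radius for all habitats AND ALL CENTRES**: under `CylSubcritical p`, for `η > 0`, an entrance depth `ρ` and a planar
scale `m` there is `R₁` such that for EVERY centre `c`, every `R ≥ R₁`, every habitat `D ⊆ B_G(c, R_w)` of planar diameter `≤ m` and
every entrance set `A ⊆ D ∩ B_G(c, ρ)`, `P_p(excess c R D A) ≤ η` — the number of possible entrances is `≤ (Δ + 1)^ρ` whatever the centre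
(degree bound (μ)), and the self-exit radius of `SkelExcess` is already uniform over all vertices (frames).  Replaces the product's
`excess_le_of_frame` (`γ c ∈ V₀`). [cite: KozmaNitzan2024, §4 Lemma 12 (p. 24)] [cite: MartineauSevero2019, Cor. 2.2] -/
theorem exists_excess_radius_uniform [Countable V] {p : unitInterval} (hC : Φ.toPlanarSkeleton.CylSubcritical p) (ρ m : ℕ) {η : ℝ}
    (hη : 0 < η) :
    ∃ R₁ : ℕ, ∀ (c : V) (R : ℕ), R₁ ≤ R → ∀ (Rw : ℕ) (D A : Finset V), (∀ d ∈ D, d ∈ graphBall G c Rw) →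
      (∀ d ∈ D, ∀ d' ∈ D, Φ.φ d - Φ.φ d' ∈ box 2 m) → A ⊆ D → (∀ a ∈ A, a ∈ graphBall G c ρ) →
        (bondPercolation G p).real (excess G c R D A) ≤ η := by
  set μ := bondPercolation G p with hμ
  -- the number of possible entrances, uniformly in the centre
  set N : ℕ := (Φ.Δ + 1) ^ ρ with hN
  have hε : 0 < η / (N + 1) := by positivity
  obtain ⟨R₀, hR₀⟩ := exists_selfExit_radius Φ hC m hε
  refine ⟨ρ + R₀, fun c R hR Rw D A hDw hDm hAD hA => ?_⟩
  have hρ : ρ ≤ R := by omega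
  have hcardA : A.card ≤ N := by
    calc A.card ≤ (ballFin G c ρ).card := Finset.card_le_card fun a ha => (mem_ballFin G).2 (hA a ha)
      _ ≤ N := card_ballFin_le G Φ.degree_le c ρ
  calc μ.real (excess G c R D A) ≤ μ.real (⋃ a ∈ A, selfExit Φ m (R - ρ) a) :=
        measureReal_mono (excess_subset_biUnion_selfExit Φ hDw hDm hAD hA hρ) (measure_ne_top _ _)
    _ ≤ ∑ a ∈ A, μ.real (selfExit Φ m (R - ρ) a) := measureReal_biUnion_finset_le _ _
    _ ≤ ∑ a ∈ A, η / (N + 1) := Finset.sum_le_sum fun a _ => hR₀ _ (by omega) a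
    _ = A.card * (η / (N + 1)) := by rw [Finset.sum_const, nsmul_eq_mul]
    _ ≤ N * (η / (N + 1)) := by gcongr
    _ ≤ η := by
        rw [mul_div_assoc']
        refine (div_le_iff₀ (by positivity)).2 ?_
        nlinarith

/-- **Rim excess from a wired source set.**  For a subbox `Qt` of `Wt` in the window graph `winGraph G w₁ R_π` (`Qt ⊆ B_G(w₁, R_π)`), a
source set `S ⊆ Qt` at depth `≤ R₀'` from the centre `c`, a point `o ∈ S`, a rim `Rim ⊆ Qt` disjoint from `S` beyond depth `r₁` from `c`,
a centre-uniform excess radius `R₁ ≤ r₁` at the running parameter, and `Qt ⊆ B_G(c, R_w)` of planar diameter `≤ m`: under the law cut to `Qt`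
with any pinning of pairs inside `S`, `P(⋃_{t ∈ Rim} o ↔ t) ≤ η`. [cite: KozmaNitzan2024, §4 Lemma 11 (p. 22), Lemma 12 (p. 24)]
[cite: MartineauSevero2019, Cor. 2.2] -/
theorem real_rim_le_of_wired_source [Countable V] {w₁ : V} {Rπ : ℕ} {Wt : Sym2 V → unitInterval} {q : unitInterval} {Qt : Finset V}
    (hWQ : IsSubbox (winGraph G w₁ Rπ) Wt q Qt) (hQπ : ∀ v ∈ Qt, v ∈ graphBall G w₁ Rπ)
    {S Rim : Finset V} (hSQ : S ⊆ Qt) (hRimQ : Rim ⊆ Qt) (hSR : Disjoint S Rim) {o : V} (ho : o ∈ S)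
    {c : V} {r₁ R₀' : ℕ} (hfar : ∀ t ∈ Rim, t ∉ graphBall G c r₁) (hnear : ∀ s ∈ S, s ∈ graphBall G c R₀')
    {m : ℕ} {η : ℝ} {R₁ : ℕ}
    (hR₁ : ∀ (c' : V) (R' : ℕ), R₁ ≤ R' → ∀ (Rw : ℕ) (D' A' : Finset V), (∀ d ∈ D', d ∈ graphBall G c' Rw) →
      (∀ d ∈ D', ∀ d' ∈ D', Φ.φ d - Φ.φ d' ∈ box 2 m) → A' ⊆ D' → (∀ a ∈ A', a ∈ graphBall G c' R₀') →
        (bondPercolation G q).real (excess G c' R' D' A') ≤ η)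
    (hR : R₁ ≤ r₁) {Rw : ℕ} (hQw : ∀ d ∈ Qt, d ∈ graphBall G c Rw) (hQm : ∀ d ∈ Qt, ∀ d' ∈ Qt, Φ.φ d - Φ.φ d' ∈ box 2 m)
    {F₀ : Set (Sym2 V)} (hF₀ : F₀ ⊆ wireSet (↑S : Set V)) (pat : Set (Sym2 V)) :
    (prodBernoulli (restrW (↑Qt : Set V) (pinW Wt F₀ pat))).real (⋃ t ∈ Rim, openConn o t) ≤ η := by
  -- under the cut law open paths stay inside `Qt`
  have h1 : (prodBernoulli (restrW (↑Qt : Set V) (pinW Wt F₀ pat))).real (⋃ t ∈ Rim, openConn o t) =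
      (prodBernoulli (pinW Wt F₀ pat)).real (⋃ t ∈ (↑Rim : Set V), openConnIn (↑Qt : Set V) o t) := by
    rw [← prodBernoulli_restrW_real_biUnion_openConn (pinW Wt F₀ pat) (↑Qt : Set V) (Finset.mem_coe.2 (hSQ ho))]
    simp only [Finset.mem_coe]
  -- a connection from `o ∈ S` inside `Qt` is a link from `S`
  have h2 : (⋃ t ∈ (↑Rim : Set V), openConnIn (↑Qt : Set V) o t) ⊆ linkIn (↑Qt : Set V) S Rim := by
    intro ω hω
    simp only [Set.mem_iUnion, exists_prop, Finset.mem_coe] at hω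
    obtain ⟨t, ht, hot⟩ := hω
    exact mem_linkIn_iff.2 ⟨o, ho, t, ht, hot⟩
  -- wiring the source does not change the link probability; the rim is far from `c`
  have h3 : linkIn (↑Qt : Set V) S Rim ⊆ excess G c r₁ Qt S := by
    rw [excess]; exact linkIn_mono le_rfl le_rfl fun t ht => Finset.mem_filter.2 ⟨hRimQ ht, hfar t ht⟩
  calc (prodBernoulli (restrW (↑Qt : Set V) (pinW Wt F₀ pat))).real (⋃ t ∈ Rim, openConn o t)
      = (prodBernoulli (pinW Wt F₀ pat)).real (⋃ t ∈ (↑Rim : Set V), openConnIn (↑Qt : Set V) o t) := h1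
    _ ≤ (prodBernoulli (pinW Wt F₀ pat)).real (linkIn (↑Qt : Set V) S Rim) := measureReal_mono h2 (measure_ne_top _ _)
    _ = (prodBernoulli Wt).real (linkIn (↑Qt : Set V) S Rim) := (real_linkIn_eq_pinW_source Wt Qt hSR hF₀ pat).symm
    _ ≤ (prodBernoulli Wt).real (excess G c r₁ Qt S) := measureReal_mono h3 (measure_ne_top _ _)
    _ = (bondPercolation G q).real (excess G c r₁ Qt S) := real_excess_eq G hWQ hQπ c r₁ S
    _ ≤ η := hR₁ c r₁ hR Rw Qt S hQw hQm hSQ hnear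

end Skel

end Transplant

end Summit.CriticalPhenomena.PercolationContinuityZ3.Theorems

end
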